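import Summits.AtomisticToContinuum.BoseEinsteinCondensation.Theorems.BECGroundStateSOSPeriodicIRBoundTwoSectorFloatingDefs
import Summits.AtomisticToContinuum.BoseEinsteinCondensation.Theorems.BECGroundStateSOSPeriodicIRBoundTwoSectorFreeGas
import Summits.AtomisticToContinuum.BoseEinsteinCondensation.Theorems.BECGroundStateSOSPeriodicIRBoundTwoSectorKLS
import Literature.MathematicalPhysics.QuantumManyBody.BoseGasDirichletWall
import HarnessLib

/-!
# Route `BECGroundStateSOS`, crux `PeriodicIRBound` (stmt-AtomisticToContinuum-3972), line `two-sector-gd-transfer`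
# (v8 "floating thresholds") — the FREE-GAS instance of the pooled stub S1' (`FloatingTwoChannel`)

Supports (does not close) stmt-AtomisticToContinuum-3972. The registered by-product stub
`stub_freeGasFloatingChannels`: at `v = 0` both KLS channel inequalities of
`…TwoSectorFloatingDefs.lean` hold on near-minimisers with thresholds floating by `μ₊ = μ₋ = 0`, and
`FloatingFor 0 K ρ₀ C` holds for every `K, ρ₀` and every `C ≥ 1/(4π²)`.

* §1 real arithmetic of the two channels (`plus_arith`, `minus_arith`).
* §2 the PARTICLE channel at `v = 0` (no near-minimiser smallness): with `a† = a†(φ_n)`, `a = a(φ_n)`,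
  `ε_n = |2πn/L|²`, the free form of the particle state is bounded below by ONE term of the kinetic Parseval
  identity, `𝓔_0[a†ψ] = ∑_q ε_q ‖a_q a†ψ‖² ≥ ε_n ‖a a†ψ‖²` (`WF.lintegral_kineticDensity_eq_tsum_normSq_modeAn`,
  `WF.qform_zero_eq`), and `‖a a†ψ‖² ≥ |⟨ψ, a a†ψ⟩|² = ‖a†ψ‖⁴ = (1 + n_k)²` by Cauchy–Schwarz on the cell
  (`Kato.norm_integral_conj_mul_le`) and adjointness (`integral_conj_modeCr_mul`, `WF.normSq_modeCr`). Hence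
  `ChanPlus 0 m L n T b` as soon as `0 ≤ T`, `0 < b`, `1 ≤ b(ε_n − T)` (`chanPlus_zero`).
* §3 the HOLE channel at `v = 0`, threshold `0`: the per-mode kinetic Markov bound
  (`FreeGas.kinetic_mode_le`) and near-minimality `𝓔_0[ψ] ≤ E₀ + δ = δ` (`periodicGroundStateEnergy_zero_eq_zero`)
  give `n_k ≤ bη` for the slack `δ = bη·4π²|n|₂²/L²`, whence `n_k² ≤ b((1+η)𝓔_0[aψ] + η n_k)` (`chanMinus_zero`).
* §4 `floatingFor_zero`: `μ₊ = μ₋ = 0`, `b = CL²/‖n‖_∞²`, `bε_n = 4π²C|n|₂²/‖n‖_∞² ≥ 4π²C ≥ 1`.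

References (shape only; nothing is cited as a fact): T. Kennedy, E. H. Lieb, B. S. Shastry, J. Stat. Phys. 53 (1988)
1019, (12)–(14); F. J. Dyson, E. H. Lieb, B. Simon, J. Stat. Phys. 18 (1978) 335, §1 (the free Bose gas saturates
Gaussian domination with `b = 1/ε`); LSSY2005 App. A.
-/

noncomputable section

open scoped BigOperators ENNReal ComplexConjugate
open Filter MeasureTheory

namespace Summit.AtomisticToContinuum.BoseEinsteinCondensation.Cruxes.PeriodicIRBound.TwoSectorGdTransfer

open Literature.MathematicalPhysics.QuantumManyBody.BoseGas
open Summit.AtomisticToContinuum.BoseEinsteinCondensation.Cruxes.PeriodicIRBound.LinearPhFloorWagner.WF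
open Summit.AtomisticToContinuum.BoseEinsteinCondensation.Theorems.GaussianDominationCan.Negative
  (nsq nsq_nonneg one_le_norm_intVec)
open Summit.AtomisticToContinuum.BoseEinsteinCondensation.Theorems.PeriodicIRBound.Negative (one_le_nsq)
open Summit.AtomisticToContinuum.BoseEinsteinCondensation.Theorems.FibreConductance.Negative (norm_sq_le_nsq)

namespace FloatingFreeGas

/-! ## §1 Real arithmetic of the two channels -/

/-- **Particle-channel arithmetic**: if `qC ≥ ε(n_k+1)²`, `0 ≤ T`, `0 < b`, `1 ≤ b(ε − T)` then
`(n_k+1)² ≤ b((1+η)(qC − T(n_k+1)) + η(n_k+1))` (`ε y² − T y ≥ (ε − T) y²` for `y = n_k + 1 ≥ 1`). [folklore] -/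
theorem plus_arith {nk qC ε T b η : ℝ} (hnk : 0 ≤ nk) (hη : 0 < η) (hb : 0 < b) (hT : 0 ≤ T)
    (hbT : 1 ≤ b * (ε - T)) (hq : ε * (nk + 1) ^ 2 ≤ qC) :
    (nk + 1) ^ 2 ≤ b * ((1 + η) * (qC - T * (nk + 1)) + η * (nk + 1)) := by
  set y : ℝ := nk + 1 with hy
  have hy1 : 1 ≤ y := by rw [hy]; linarith
  have hy0 : 0 ≤ y := by linarith
  have hyy : y ≤ y ^ 2 := by nlinarith
  have hTy : T * y ≤ T * y ^ 2 := mul_le_mul_of_nonneg_left hyy hT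
  have h1 : (ε - T) * y ^ 2 ≤ qC - T * y := by nlinarith
  have h2 : y ^ 2 ≤ b * (qC - T * y) := by
    have h3 := mul_le_mul_of_nonneg_left h1 hb.le
    have h4 := mul_le_mul_of_nonneg_right hbT (sq_nonneg y)
    nlinarith
  have h3 : 0 ≤ b * (qC - T * y) := le_trans (sq_nonneg y) h2
  nlinarith [mul_nonneg hη.le h3, mul_nonneg hb.le (mul_nonneg hη.le hy0)]

/-- **Hole-channel arithmetic**: if `c·n_k ≤ bη·c` with `c > 0` and `qA ≥ 0` then
`n_k² ≤ b((1+η)(qA − 0·n_k) + η n_k)`. [folklore] -/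
theorem minus_arith {nk qA b η c : ℝ} (hnk : 0 ≤ nk) (hη : 0 < η) (hb : 0 < b) (hqA : 0 ≤ qA)
    (hc : 0 < c) (hkin : c * nk ≤ b * η * c) : nk ^ 2 ≤ b * ((1 + η) * (qA - 0 * nk) + η * nk) := by
  have h1 : nk ≤ b * η := by
    have h : c * nk ≤ c * (b * η) := by linarith
    exact le_of_mul_le_mul_left h hc
  have h2 : nk ^ 2 ≤ b * η * nk := by nlinarith
  have h3 : 0 ≤ b * ((1 + η) * qA) := by positivity
  nlinarith

/-! ## §2 The particle channel at `v = 0` -/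

/-- **Cauchy–Schwarz step**: `(n_k + 1)² = ‖a†ψ‖⁴ = |⟨ψ, a a†ψ⟩|² ≤ ‖ψ‖²‖a a†ψ‖² = ‖a a†ψ‖²` for a normalised
periodic trial state `ψ` (`a = a(φ_n)`, adjointness `integral_conj_modeCr_mul`, `‖a†ψ‖² = 1 + n_k` by
`WF.normSq_modeCr`). [cite: LSSY2005, App. A (A.11), (A.13)–(A.14)] -/
theorem sq_le_normSq_modeAn_modeCr {m : ℕ} {L : ℝ} (hL : 0 < L) (n : Fin 3 → ℤ)
    (Ψ : PeriodicTrialState (m + 2) L) :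
    ((cellOccupation (m + 2) L (planeWaveMode L n) Ψ.ψ).toReal + 1) ^ 2 ≤
      (normSq L (modeAn L (planeWaveMode L n) (modeCr (planeWaveMode L n) Ψ.ψ))).toReal := by
  -- adapted from `FreeGas.transfer_sq_le_occupation` (Theorems/BECGroundStateSOSPeriodicIRBoundTwoSectorFreeGas.lean)
  set ψ : Config (m + 2) → ℂ := Ψ.ψ with hψ
  have hψc : IsCore L ψ := isCore_trialState Ψ
  have hψ1 : normSq L ψ = 1 := Ψ.norm_eq
  set cΨ : Config (m + 2 + 1) → ℂ := modeCr (planeWaveMode L n) ψ with hcΨ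
  have hcΨc : IsCore L cΨ := isCore_modeCr hL n hψc
  set gΨ : Config (m + 2) → ℂ := modeAn L (planeWaveMode L n) cΨ with hgΨ
  have hgΨc : IsCore L gΨ := isCore_modeAn hL n hcΨc
  have hψcont : Continuous ψ := hψc.contDiff.continuous
  have hcΨcont : Continuous cΨ := hcΨc.contDiff.continuous
  have hgΨcont : Continuous gΨ := hgΨc.contDiff.continuous
  -- the occupation is finite
  set νE : ℝ≥0∞ := cellOccupation (m + 2) L (planeWaveMode L n) ψ with hνE
  have hνle : νE ≤ ((m + 2 : ℕ) : ℝ≥0∞) * normSq L ψ := cellOccupation_le_mul_normSq hL n hψcont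
  rw [hψ1, mul_one] at hνle
  have hνtop : νE ≠ ⊤ := ne_top_of_le_ne_top (ENNReal.natCast_ne_top _) hνle
  -- `‖a†ψ‖² = 1 + n_k`
  have hnC : normSq L cΨ = 1 + νE := by rw [hcΨ, normSq_modeCr hL n hψc, hψ1]
  have hnCr : (normSq L cΨ).toReal = νE.toReal + 1 := by
    rw [hnC, ENNReal.toReal_add ENNReal.one_ne_top hνtop, ENNReal.toReal_one]; ring
  -- adjointness: `⟨ψ, a a†ψ⟩ = ⟨a†ψ, a†ψ⟩ = 1 + n_k`
  have hadj : ∫ Y in cellN (m + 2) L, conj (ψ Y) * gΨ Y = ((νE.toReal + 1 : ℝ) : ℂ) := by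
    rw [hgΨ, ← integral_conj_modeCr_mul (continuous_planeWaveMode L n).measurable (norm_planeWaveMode_le L n)
      hψcont hcΨcont hcΨc.symm, integral_conj_mul_self_eq L hcΨcont, hnCr]
  -- Cauchy–Schwarz on the cell
  have hCS := Kato.norm_integral_conj_mul_le L hψcont hgΨcont
    (show normSq L ψ ≠ ⊤ by rw [hψ1]; exact ENNReal.one_ne_top) (normSq_ne_top L hgΨcont)
  change ‖∫ Y in cellN (m + 2) L, conj (ψ Y) * gΨ Y‖ ≤
    Real.sqrt (normSq L ψ).toReal * Real.sqrt (normSq L gΨ).toReal at hCS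
  have h0 : 0 ≤ νE.toReal + 1 := by positivity
  rw [hadj, hψ1, ENNReal.toReal_one, Real.sqrt_one, one_mul, Complex.norm_real, Real.norm_of_nonneg h0] at hCS
  calc (νE.toReal + 1) ^ 2 ≤ (Real.sqrt ((normSq L gΨ).toReal)) ^ 2 := pow_le_pow_left₀ h0 hCS 2
    _ = (normSq L gΨ).toReal := Real.sq_sqrt ENNReal.toReal_nonneg

/-- **The free form of the particle state dominates `ε_n (n_k+1)²`**: `𝓔_0[a†ψ] = ∑_q ε_q ‖a_q a†ψ‖² ≥ ε_n ‖a a†ψ‖²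
≥ ε_n (n_k + 1)²` (kinetic Parseval `WF.lintegral_kineticDensity_eq_tsum_normSq_modeAn`, one term kept, and
`sq_le_normSq_modeAn_modeCr`). [cite: LSSY2005, App. A (A.6), (A.10)] -/
theorem eps_mul_sq_le_qform_zero_modeCr {m : ℕ} {L : ℝ} (hL : 0 < L) (n : Fin 3 → ℤ)
    (Ψ : PeriodicTrialState (m + 2) L) :
    ‖latticeVec (2 * Real.pi / L) n‖ ^ 2 * ((cellOccupation (m + 2) L (planeWaveMode L n) Ψ.ψ).toReal + 1) ^ 2 ≤
      (qform 0 L (modeCr (planeWaveMode L n) Ψ.ψ)).toReal := by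
  have hψc : IsCore L Ψ.ψ := isCore_trialState Ψ
  have hcΨc : IsCore L (modeCr (planeWaveMode L n) Ψ.ψ) := isCore_modeCr hL n hψc
  -- one term of the kinetic Parseval identity
  have hkin : eps L n * normSq L (modeAn L (planeWaveMode L n) (modeCr (planeWaveMode L n) Ψ.ψ)) ≤
      qform 0 L (modeCr (planeWaveMode L n) Ψ.ψ) := by
    rw [qform_zero_eq, lintegral_kineticDensity_eq_tsum_normSq_modeAn hL hcΨc]
    exact ENNReal.le_tsum n
  have htop : qform 0 L (modeCr (planeWaveMode L n) Ψ.ψ) ≠ ⊤ := qform_zero_ne_top L hcΨc.contDiff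
  have h := ENNReal.toReal_mono htop hkin
  rw [ENNReal.toReal_mul, toReal_eps] at h
  exact le_trans (mul_le_mul_of_nonneg_left (sq_le_normSq_modeAn_modeCr hL n Ψ) (sq_nonneg _)) h

/-- **The particle channel on the free gas**: `ChanPlus 0 m L n T b` for `0 ≤ T`, `0 < b`, `1 ≤ b(ε_n − T)` — for every
`η > 0` ANY slack works (here `δ = 1`): no near-minimality is used. [cite: KLS1988JSP, (12)] -/
theorem chanPlus_zero (m : ℕ) {L : ℝ} (hL : 0 < L) (n : Fin 3 → ℤ) {b T : ℝ} (hb : 0 < b) (hT : 0 ≤ T)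
    (hbT : 1 ≤ b * (‖latticeVec (2 * Real.pi / L) n‖ ^ 2 - T)) : ChanPlus 0 m L n T b := by
  intro η hη
  refine ⟨1, one_pos, fun Ψ _ => ?_⟩
  dsimp only
  exact plus_arith ENNReal.toReal_nonneg hη hb hT hbT (eps_mul_sq_le_qform_zero_modeCr hL n Ψ)

/-! ## §3 The hole channel at `v = 0`, threshold `0` -/

/-- **The hole channel on the free gas at threshold `0`**: `ChanMinus 0 m L n 0 b` for `n ≠ 0`, `0 < b` — slack
`δ = bη·4π²|n|₂²/L²`, per-mode kinetic Markov `4π²|n|₂²/L² · n_k ≤ 𝓔_0[ψ] ≤ E₀ + δ = δ` (`FreeGas.kinetic_mode_le`,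
`periodicGroundStateEnergy_zero_eq_zero`), so `n_k ≤ bη` and `n_k² ≤ bη n_k`. [cite: KLS1988JSP, (12)] -/
theorem chanMinus_zero (m : ℕ) {L : ℝ} (hL : 0 < L) {n : Fin 3 → ℤ} (hn : n ≠ 0) {b : ℝ} (hb : 0 < b) :
    ChanMinus 0 m L n 0 b := by
  intro η hη
  set c : ℝ := 4 * Real.pi ^ 2 * nsq n / L ^ 2 with hc
  have hcpos : 0 < c :=
    div_pos (mul_pos (by positivity) (lt_of_lt_of_le one_pos (one_le_nsq hn))) (pow_pos hL 2)
  have hbηc : 0 < b * η * c := by positivity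
  refine ⟨ENNReal.ofReal (b * η * c), ENNReal.ofReal_pos.2 hbηc, fun Ψ hΨ => ?_⟩
  dsimp only
  have hE : periodicEnergy 0 Ψ ≤ ENNReal.ofReal (b * η * c) := by
    have h : periodicEnergy 0 Ψ ≤ periodicGroundStateEnergy 0 (m + 2) L + ENNReal.ofReal (b * η * c) := hΨ
    rwa [periodicGroundStateEnergy_zero_eq_zero (m + 2) hL, zero_add] at h
  have hEtop : periodicEnergy 0 Ψ ≠ ⊤ := ne_top_of_le_ne_top ENNReal.ofReal_ne_top hE
  have hEr : (periodicEnergy 0 Ψ).toReal ≤ b * η * c := by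
    have h := ENNReal.toReal_mono ENNReal.ofReal_ne_top hE
    rwa [ENNReal.toReal_ofReal hbηc.le] at h
  have hkin := FreeGas.kinetic_mode_le hL n Ψ hEtop
  exact minus_arith ENNReal.toReal_nonneg hη hb ENNReal.toReal_nonneg hcpos (hkin.trans hEr)

/-! ## §4 `FloatingFor 0 K ρ₀ C` for every `K, ρ₀` and `C ≥ 1/(4π²)` -/

/-- `1 ≤ b ε_n` for the bound `b = CL²/‖n‖_∞²`, `C ≥ 1/(4π²)`: `ε_n = 4π²|n|₂²/L²` (`norm_waveVector_sq`) and
`‖n‖_∞² ≤ |n|₂²` (`FibreConductance.Negative.norm_sq_le_nsq`). [folklore] -/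
theorem one_le_bound_mul_eps {L C : ℝ} (hL : 0 < L) {n : Fin 3 → ℤ} (hn : n ≠ 0)
    (hC : 1 / (4 * Real.pi ^ 2) ≤ C) :
    1 ≤ C * L ^ 2 / ‖(fun j => (n j : ℝ))‖ ^ 2 * (‖latticeVec (2 * Real.pi / L) n‖ ^ 2 - 0) := by
  rw [sub_zero, ← waveVector_eq_latticeVec, norm_waveVector_sq]
  change 1 ≤ C * L ^ 2 / ‖(fun j => (n j : ℝ))‖ ^ 2 * (4 * Real.pi ^ 2 * nsq n / L ^ 2)
  have hn1 : 1 ≤ ‖(fun j => (n j : ℝ))‖ := one_le_norm_intVec hn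
  have hnsq : ‖(fun j => (n j : ℝ))‖ ^ 2 ≤ nsq n := norm_sq_le_nsq n
  have hπ : (0 : ℝ) < 4 * Real.pi ^ 2 := by positivity
  have hns0 : (0 : ℝ) < ‖(fun j => (n j : ℝ))‖ ^ 2 := by positivity
  have hL0 : L ≠ 0 := hL.ne'
  have h1 : 1 ≤ 4 * Real.pi ^ 2 * C := by
    have h := (div_le_iff₀ hπ).1 hC
    linarith
  have h2 : 1 ≤ nsq n / ‖(fun j => (n j : ℝ))‖ ^ 2 := (one_le_div hns0).2 hnsq
  calc (1 : ℝ) ≤ 4 * Real.pi ^ 2 * C := h1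
    _ ≤ 4 * Real.pi ^ 2 * C * (nsq n / ‖(fun j => (n j : ℝ))‖ ^ 2) := le_mul_of_one_le_right (by linarith) h2
    _ = C * L ^ 2 / ‖(fun j => (n j : ℝ))‖ ^ 2 * (4 * Real.pi ^ 2 * nsq n / L ^ 2) := by
        field_simp

/-- **S1' on the free gas**: `FloatingFor 0 K ρ₀ C` for ALL `K, ρ₀ ∈ ℝ` and every `C ≥ 1/(4π²)`, with `μ₊ = μ₋ = 0` at
every `N = m + 2` and every mode `n ≠ 0` (the momentum window and the density condition are idle; `E₀ ≡ 0`).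
[cite: DLS1978, §1] -/
theorem floatingFor_zero (K ρ₀ : ℝ) {C : ℝ} (hC : 1 / (4 * Real.pi ^ 2) ≤ C) : FloatingFor 0 K ρ₀ C := by
  intro ε hε ρ hρ _
  refine Filter.Eventually.of_forall fun m n hn _ => ?_
  have hL : 0 < sideLength ρ (m + 2) := sideLength_pos_of_pos hρ (by omega)
  have hn1 : 1 ≤ ‖(fun j => (n j : ℝ))‖ := one_le_norm_intVec hn
  have hb : 0 < C * sideLength ρ (m + 2) ^ 2 / ‖(fun j => (n j : ℝ))‖ ^ 2 := by
    have hCpos : 0 < C := lt_of_lt_of_le (by positivity) hC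
    positivity
  refine ⟨0, 0, le_rfl, ?_, ?_, ?_⟩
  · rw [zero_add]
    exact div_nonneg (mul_nonneg hε.le (Real.sqrt_nonneg _)) hL.le
  · rw [periodicGroundStateEnergy_zero_eq_zero (m + 2) hL, ENNReal.toReal_zero, add_zero]
    exact chanPlus_zero m hL n hb le_rfl (one_le_bound_mul_eps hL hn hC)
  · rw [periodicGroundStateEnergy_zero_eq_zero (m + 2) hL, ENNReal.toReal_zero, sub_zero]
    exact chanMinus_zero m hL hn hb

end FloatingFreeGas

/-- **Registered by-product stub `stub_freeGasFloatingChannels` of the crux ledger** (line `two-sector-gd-transfer`, v8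
"floating thresholds"): the FREE-GAS instance of the pooled stub S1' — at `v = 0` the particle channel holds against
every threshold `T ≥ 0` with every bound `b > 0` such that `b(ε_n − T) ≥ 1`, the hole channel holds against the threshold
`0` with every `b > 0`, and `FloatingFor 0 K ρ₀ C` holds for all `K, ρ₀` and every `C ≥ 1/(4π²)`
(`FloatingFreeGas.chanPlus_zero`, `FloatingFreeGas.chanMinus_zero`, `FloatingFreeGas.floatingFor_zero`). [folklore] -/
theorem stub_freeGasFloatingChannels : (∀ (m : ℕ) (L : ℝ) (n : Fin 3 → ℤ) (b T : ℝ), 0 < L → n ≠ 0 → 0 < b →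
    0 ≤ T → 1 ≤ b * (‖latticeVec (2 * Real.pi / L) n‖ ^ 2 - T) → ChanPlus 0 m L n T b) ∧
    (∀ (m : ℕ) (L : ℝ) (n : Fin 3 → ℤ) (b : ℝ), 0 < L → n ≠ 0 → 0 < b → ChanMinus 0 m L n 0 b) ∧
    (∀ K ρ₀ C : ℝ, 1 / (4 * Real.pi ^ 2) ≤ C → FloatingFor 0 K ρ₀ C) :=
  ⟨fun m _ n _ _ hL _ hb hT hbT => FloatingFreeGas.chanPlus_zero m hL n hb hT hbT,
    fun m _ _ _ hL hn hb => FloatingFreeGas.chanMinus_zero m hL hn hb,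
    fun K ρ₀ _ hC => FloatingFreeGas.floatingFor_zero K ρ₀ hC⟩

end Summit.AtomisticToContinuum.BoseEinsteinCondensation.Cruxes.PeriodicIRBound.TwoSectorGdTransfer

end
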